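import Literature.Topology.FourManifolds.ExitBend
import Literature.Topology.FourManifolds.KnotFamilyAmbientIsotopy
import HarnessLib

/-!
# The exit host: the bent knot with its unit window replaced by the straight segment

Topic `Literature/Topology/FourManifolds` (trunk T-4MAN). Fact seat
`provefact-Literature.Topology.FourManifolds.Knot.IsConnectedSum.isIsotopic` (Schubert's theorem),
geometric heart for rail knots. The bent knot of a clear wall frame (`ExitBend.lean`) runs, near
the centre `oS`, along the line `O + ρ dLo` (blow-up coordinates): inward along the lower straight
spike (`ρ = -ψ₁(αLo t)` from `-1/2` to `-2 r_A`), through the unit (coordinate radius `≤ 2 r_A`),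
and outward along the rotated upper spike (`ρ = ψ₁(αHi t)` from `2 r_A` to `1/2`). The **host** is
the simple regular loop obtained by replacing the whole window by the straight segment
`ρ ∈ [-1/2, 1/2]`; the insertion arguments to follow compare bent knots with the same unit inside
isotopic hosts. This file constructs the host and its **clock** on the window:

* § clock points: the parameters `b.clockLo HU hl v`, `b.clockHi HU hl v` (`v ∈ [1/4, 1/2]`) of the
  two straight spikes at which the ray scalar `ψ₁ = spikeScalar (1 - λ₀)` takes the value `v`
  (intermediate value theorem; `λ₀ ≤ 1/2`), with their blown-up parameters in `(3/8, 3/4)`,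
  membership of the open cores and of the content set, and their ordering;
* § the clock: the window `W = [w₁, w₂]` (`ψ₁ = 1/2` on both sides), the inner points `p₁, q₁, p₂`
  (`ψ₁ = 3/8, 5/16, 1/4` on the lower side) and `p₄, q₂, p₅` (`1/4, 5/16, 3/8` on the upper side),
  and the glued clock `r = (1 - β)(-ψ₁ ∘ αLo) + ν β₃ + β₂ (ψ₁ ∘ αHi - ν β₃)` (`β, β₃, β₂` smooth steps
  over `[p₁, p₂]`, `[q₁, q₂]`, `[p₄, p₅]`, `ν = 1/8`): it is `C^∞`, equals `-ψ₁ ∘ αLo` on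
  `[w₁, p₁]` and `ψ₁ ∘ αHi` on `[p₅, w₂]`, has positive derivative on `W`, hence is strictly
  increasing there, from `-1/2` to `1/2`;
* § the host: `hostPiece = curve of the bent knot + θ_W • (straight - curve)` with the straight
  piece `ψ⁻¹ (blowDown (O + r dLo))` and a plateau `θ_W` (`1` on `[p₁, p₅]`, `0` off `(w₁, w₂)`); it
  agrees with the bent knot off `(p₁, p₅)`, with the straight piece on `W`, is `C^∞`, unit,
  regular and injective on the fundamental domain, whence the **host knot** `b.hostKnot …` with its
  pointwise description.

Everything is proved; no named facts are introduced.

## References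

* M. W. Hirsch, *Differential Topology*, GTM 33, Springer (1976), Ch. 8 §1. [HirschDT1976]
-/

open scoped Manifold ContDiff Topology Real RealInnerProductSpace
open Function Set Metric Filter

noncomputable section

namespace Literature.Topology.FourManifolds

/-- Local notation: `𝔼 n` is the model Euclidean space `EuclideanSpace ℝ (Fin n)`. -/
local notation "𝔼 " n:arg => EuclideanSpace ℝ (Fin n)

/-- Local notation: `𝕊 n` is the unit sphere in `EuclideanSpace ℝ (Fin (n + 1))`. -/
local notation "𝕊 " n:arg => (Metric.sphere (0 : EuclideanSpace ℝ (Fin (n + 1))) 1)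

attribute [local instance] fact_finrank_euclideanSpace_succ

open KnotsInBall ExitBend

namespace BandData

/-! ### Values of the ray scalar -/

/-- The ray scalar at the junction parameter `3/8` is `5/6`. [folklore] -/
theorem spikeScalar_three_eighths (c : ℝ) : spikeScalar c (3 / 8) = 5 / 6 := by
  rw [spikeScalar, spikeWin_eq_zero (by norm_num)]; norm_num

/-- The ray scalar at `3/4` is `(1 - c)/3`. [folklore] -/
theorem spikeScalar_three_quarters (c : ℝ) : spikeScalar c (3 / 4) = (1 - c) / 3 := by
  rw [spikeScalar, spikeWin_eq_one (by norm_num)]; ring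

/-- The ray scalar at `0` is `4/3`. [folklore] -/
theorem spikeScalar_zero_right (c : ℝ) : spikeScalar c 0 = 4 / 3 := by
  rw [spikeScalar, spikeWin_eq_zero (by norm_num)]; norm_num

/-- Beyond `1` the ray scalar is nonpositive (`c < 1`). [folklore] -/
theorem spikeScalar_nonpos {c α : ℝ} (hc : c ∈ Ico (0 : ℝ) 1) (hα : 1 ≤ α) : spikeScalar c α ≤ 0 := by
  rw [spikeScalar, spikeWin_eq_one (by linarith)]
  have h1 : 0 ≤ 1 - 1 * c := by linarith [hc.2]
  have h2 : 1 - (α - 1 / 4) / (3 / 4) ≤ 0 := by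
    rw [sub_nonpos, le_div_iff₀ (by norm_num)]; linarith
  exact mul_nonpos_of_nonneg_of_nonpos h1 h2

/-- **Localisation of the blown-up parameter by the ray scalar**: if `spikeScalar c α ∈ [1/4, 1/2]`
and `(1 - c)/3 < 1/4` then `α ∈ (3/8, 3/4)`. [folklore] -/
theorem mem_Ioo_of_spikeScalar_mem {c α : ℝ} (hc : c ∈ Ico (0 : ℝ) 1) (hc3 : (1 - c) / 3 < 1 / 4)
    (h : spikeScalar c α ∈ Icc (1 / 4 : ℝ) (1 / 2)) : α ∈ Ioo (3 / 8 : ℝ) (3 / 4) := by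
  have hα1 : α < 1 := by
    by_contra hle; push Not at hle
    linarith [spikeScalar_nonpos hc hle, h.1]
  have hanti := strictAntiOn_spikeScalar hc
  constructor
  · by_contra hle; push Not at hle
    have : spikeScalar c (3 / 8) ≤ spikeScalar c α :=
      hanti.antitoneOn (show α ∈ Iio (1:ℝ) from hα1) (show (3/8:ℝ) ∈ Iio (1:ℝ) by norm_num) hle
    rw [spikeScalar_three_eighths] at this
    linarith [h.2]
  · by_contra hle; push Not at hle
    have : spikeScalar c α ≤ spikeScalar c (3 / 4) :=
      hanti.antitoneOn (show (3/4:ℝ) ∈ Iio (1:ℝ) by norm_num) (show α ∈ Iio (1:ℝ) from hα1) hle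
    rw [spikeScalar_three_quarters] at this
    linarith [h.1]

variable {A B K : Knot} {avoid : Set (𝕊 3)} (b : BandData A B K avoid)
  {hcross : b.band ⁻¹' sphereEquator 2 ∩ squareNhd b.δ = {x ∈ squareNhd b.δ | x 0 = 2⁻¹}}
  {ε r A' κ : ℝ} (HU : b.ShrinkScaleU hcross ε r A' κ) {lam₀ : ℝ} (hl : lam₀ ∈ Ioc (0 : ℝ) 1) (hl2 : lam₀ ≤ 1 / 2)

/-! ### The ray scalars along the two straight spikes -/

/-- The lower ray scalar `ψ₁(αLo t)` at `u = 1`. [folklore] -/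
def psiLo (κ lam₀ t : ℝ) : ℝ := spikeScalar (1 * (1 - lam₀)) (b.alphaLo κ t)

/-- The upper ray scalar `ψ₁(αHi t)` at `u = 1`. [folklore] -/
def psiHi (κ lam₀ t : ℝ) : ℝ := spikeScalar (1 * (1 - lam₀)) (b.alphaHi κ t)

/-- The lower ray scalar is `C^∞`. [folklore] -/
theorem contDiff_psiLo (κ lam₀ : ℝ) : ContDiff ℝ ∞ (b.psiLo κ lam₀) :=
  (contDiff_spikeScalar _).comp (b.contDiff_alphaLo κ)

/-- The upper ray scalar is `C^∞`. [folklore] -/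
theorem contDiff_psiHi (κ lam₀ : ℝ) : ContDiff ℝ ∞ (b.psiHi κ lam₀) :=
  (contDiff_spikeScalar _).comp (b.contDiff_alphaHi κ)

include hl in
/-- The family parameter `c = 1 - λ₀` lies in `[0, 1)`. [folklore] -/
theorem cOne_mem : 1 * (1 - lam₀) ∈ Ico (0 : ℝ) 1 := cParam_mem hl ⟨zero_le_one, le_rfl⟩

include hl2 in
/-- For `λ₀ ≤ 1/2` the ray scalar at `3/4` is below `1/4`. [folklore] -/
theorem cOne_small : (1 - 1 * (1 - lam₀)) / 3 < 1 / 4 := by linarith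

include hl in
/-- **The lower ray scalar has negative derivative** where `αLo < 1`, on the closed lower core.
[folklore] -/
theorem hasDerivAt_psiLo_neg (hκ : 0 < κ) {t : ℝ} (ht : t ∈ Icc (b.tcLo - b.epsLo / 8) (b.tcLo + b.epsLo / 8))
    (hα : b.alphaLo κ t < 1) : ∃ D < 0, HasDerivAt (b.psiLo κ lam₀) D t := by
  have hc := cOne_mem hl
  have hψ := ((contDiff_spikeScalar (1 * (1 - lam₀))).differentiable (by simp)) (b.alphaLo κ t)
  refine ⟨_, ?_, hψ.hasDerivAt.comp t (b.hasDerivAt_alphaLo κ t)⟩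
  exact mul_neg_of_neg_of_pos (deriv_spikeScalar_neg hc hα) (div_pos (b.deriv_chiLo_pos ht) hκ)

include hl in
/-- **The upper ray scalar has positive derivative** where `αHi < 1`, on the closed upper core.
[folklore] -/
theorem hasDerivAt_psiHi_pos (hκ : 0 < κ) {t : ℝ} (ht : t ∈ Icc (b.tcHi - b.epsHi / 8) (b.tcHi + b.epsHi / 8))
    (hα : b.alphaHi κ t < 1) : ∃ D > 0, HasDerivAt (b.psiHi κ lam₀) D t := by
  have hc := cOne_mem hl
  have hψ := ((contDiff_spikeScalar (1 * (1 - lam₀))).differentiable (by simp)) (b.alphaHi κ t)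
  refine ⟨_, ?_, hψ.hasDerivAt.comp t (b.hasDerivAt_alphaHi κ t)⟩
  exact mul_pos_of_neg_of_neg (deriv_spikeScalar_neg hc hα) (div_neg_of_neg_of_pos (b.deriv_chiHi_neg ht) hκ)

/-! ### Clock points -/

include HU hl in
/-- **Existence of lower clock points**: for `v ∈ [1/4, 1/2]` there is a parameter of
`[tcLo, tcLo + epsLo/8]` at which the lower ray scalar is `v`. [folklore] -/
theorem exists_clockLo {v : ℝ} (hv : v ∈ Icc (1 / 4 : ℝ) (1 / 2)) :
    ∃ t ∈ Icc b.tcLo (b.tcLo + b.epsLo / 8), b.psiLo κ lam₀ t = v := by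
  have hκ := HU.cone.spike.κ_pos
  have hc := cOne_mem hl
  have hε := b.epsLo_bounds.1
  have h0 : b.psiLo κ lam₀ b.tcLo = 4 / 3 := by
    rw [psiLo, alphaLo, chiLo_tcLo]; simp [spikeScalar_zero_right]
  have h7 : 7 ≤ b.alphaLo κ (b.tcLo + b.epsLo / 8) := by
    rw [alphaLo, le_div_iff₀ hκ]
    have : b.gapLo ≤ b.chiLo (b.tcLo + b.epsLo / 8) - 1 / 2 := min_le_left _ _
    linarith [HU.cone.spike.seven_le_gapLo]
  have h1 : b.psiLo κ lam₀ (b.tcLo + b.epsLo / 8) ≤ 0 := spikeScalar_nonpos hc (by linarith)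
  have hcont : ContinuousOn (b.psiLo κ lam₀) (Icc b.tcLo (b.tcLo + b.epsLo / 8)) :=
    (b.contDiff_psiLo κ lam₀).continuous.continuousOn
  have hmem : v ∈ Icc (b.psiLo κ lam₀ (b.tcLo + b.epsLo / 8)) (b.psiLo κ lam₀ b.tcLo) :=
    ⟨by linarith [hv.1], by rw [h0]; linarith [hv.2]⟩
  obtain ⟨t, ht, hteq⟩ := intermediate_value_Icc' (by linarith) hcont hmem
  exact ⟨t, ht, hteq⟩

include HU hl in
/-- **Existence of upper clock points.** [folklore] -/
theorem exists_clockHi {v : ℝ} (hv : v ∈ Icc (1 / 4 : ℝ) (1 / 2)) :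
    ∃ t ∈ Icc (b.tcHi - b.epsHi / 8) b.tcHi, b.psiHi κ lam₀ t = v := by
  have hκ := HU.cone.spike.κ_pos
  have hc := cOne_mem hl
  have hε := b.epsHi_bounds.1
  have h0 : b.psiHi κ lam₀ b.tcHi = 4 / 3 := by
    rw [psiHi, alphaHi, chiHi_tcHi]; simp [spikeScalar_zero_right]
  have h7 : 7 ≤ b.alphaHi κ (b.tcHi - b.epsHi / 8) := by
    rw [alphaHi, le_div_iff₀ hκ]
    have : b.gapHi ≤ b.chiHi (b.tcHi - b.epsHi / 8) - 1 / 2 := min_le_left _ _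
    linarith [HU.cone.spike.seven_le_gapHi]
  have h1 : b.psiHi κ lam₀ (b.tcHi - b.epsHi / 8) ≤ 0 := spikeScalar_nonpos hc (by linarith)
  have hcont : ContinuousOn (b.psiHi κ lam₀) (Icc (b.tcHi - b.epsHi / 8) b.tcHi) :=
    (b.contDiff_psiHi κ lam₀).continuous.continuousOn
  have hmem : v ∈ Icc (b.psiHi κ lam₀ (b.tcHi - b.epsHi / 8)) (b.psiHi κ lam₀ b.tcHi) :=
    ⟨by linarith [hv.1], by rw [h0]; linarith [hv.2]⟩
  obtain ⟨t, ht, hteq⟩ := intermediate_value_Icc (by linarith) hcont hmem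
  exact ⟨t, ht, hteq⟩

/-- **The lower clock point** of value `v ∈ [1/4, 1/2]`. [folklore] -/
def clockLo {v : ℝ} (hv : v ∈ Icc (1 / 4 : ℝ) (1 / 2)) : ℝ := (b.exists_clockLo HU hl hv).choose

/-- **The upper clock point** of value `v ∈ [1/4, 1/2]`. [folklore] -/
def clockHi {v : ℝ} (hv : v ∈ Icc (1 / 4 : ℝ) (1 / 2)) : ℝ := (b.exists_clockHi HU hl hv).choose

/-- Specification of the lower clock point. [folklore] -/
theorem clockLo_spec {v : ℝ} (hv : v ∈ Icc (1 / 4 : ℝ) (1 / 2)) :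
    b.clockLo HU hl hv ∈ Icc b.tcLo (b.tcLo + b.epsLo / 8) ∧ b.psiLo κ lam₀ (b.clockLo HU hl hv) = v :=
  (b.exists_clockLo HU hl hv).choose_spec

/-- Specification of the upper clock point. [folklore] -/
theorem clockHi_spec {v : ℝ} (hv : v ∈ Icc (1 / 4 : ℝ) (1 / 2)) :
    b.clockHi HU hl hv ∈ Icc (b.tcHi - b.epsHi / 8) b.tcHi ∧ b.psiHi κ lam₀ (b.clockHi HU hl hv) = v :=
  (b.exists_clockHi HU hl hv).choose_spec

/-- The lower clock point lies in the closed lower core. [folklore] -/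
theorem clockLo_mem_core {v : ℝ} (hv : v ∈ Icc (1 / 4 : ℝ) (1 / 2)) :
    b.clockLo HU hl hv ∈ Icc (b.tcLo - b.epsLo / 8) (b.tcLo + b.epsLo / 8) := by
  have h := (b.clockLo_spec HU hl hv).1
  have hε := b.epsLo_bounds.1
  exact ⟨by linarith [h.1], h.2⟩

/-- The upper clock point lies in the closed upper core. [folklore] -/
theorem clockHi_mem_core {v : ℝ} (hv : v ∈ Icc (1 / 4 : ℝ) (1 / 2)) :
    b.clockHi HU hl hv ∈ Icc (b.tcHi - b.epsHi / 8) (b.tcHi + b.epsHi / 8) := by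
  have h := (b.clockHi_spec HU hl hv).1
  have hε := b.epsHi_bounds.1
  exact ⟨h.1, by linarith [h.2]⟩

include hl2 in
/-- The blown-up parameter of a lower clock point lies in `(3/8, 3/4)`. [folklore] -/
theorem alphaLo_clockLo_mem {v : ℝ} (hv : v ∈ Icc (1 / 4 : ℝ) (1 / 2)) :
    b.alphaLo κ (b.clockLo HU hl hv) ∈ Ioo (3 / 8 : ℝ) (3 / 4) :=
  mem_Ioo_of_spikeScalar_mem (cOne_mem hl) (cOne_small hl2) (by rw [← psiLo, (b.clockLo_spec HU hl hv).2]; exact hv)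

include hl2 in
/-- The blown-up parameter of an upper clock point lies in `(3/8, 3/4)`. [folklore] -/
theorem alphaHi_clockHi_mem {v : ℝ} (hv : v ∈ Icc (1 / 4 : ℝ) (1 / 2)) :
    b.alphaHi κ (b.clockHi HU hl hv) ∈ Ioo (3 / 8 : ℝ) (3 / 4) :=
  mem_Ioo_of_spikeScalar_mem (cOne_mem hl) (cOne_small hl2) (by rw [← psiHi, (b.clockHi_spec HU hl hv).2]; exact hv)

include hl2 in
/-- Lower clock points are content parameters. [folklore] -/
theorem clockLo_mem_contentSet {v : ℝ} (hv : v ∈ Icc (1 / 4 : ℝ) (1 / 2)) :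
    b.clockLo HU hl hv ∈ b.contentSet HU.cone.spike.κ_pos HU.cone.spike.seven_le_gapLo HU.cone.spike.seven_le_gapHi :=
  b.mem_contentSet_of_coreLo HU (b.clockLo_mem_core HU hl hv) (b.alphaLo_clockLo_mem HU hl hl2 hv).1.le

include hl2 in
/-- Upper clock points are content parameters. [folklore] -/
theorem clockHi_mem_contentSet {v : ℝ} (hv : v ∈ Icc (1 / 4 : ℝ) (1 / 2)) :
    b.clockHi HU hl hv ∈ b.contentSet HU.cone.spike.κ_pos HU.cone.spike.seven_le_gapLo HU.cone.spike.seven_le_gapHi :=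
  b.mem_contentSet_of_coreHi HU (b.clockHi_mem_core HU hl hv) (b.alphaHi_clockHi_mem HU hl hl2 hv).1.le

include HU hl in
/-- **Monotonicity of the lower ray scalar on the lower core below `αLo = 1`**: for core parameters
`s < t` with `αLo t < 1`, `ψLo t < ψLo s`. [folklore] -/
theorem psiLo_lt_psiLo {s t : ℝ} (hs : s ∈ Icc (b.tcLo - b.epsLo / 8) (b.tcLo + b.epsLo / 8))
    (ht : t ∈ Icc (b.tcLo - b.epsLo / 8) (b.tcLo + b.epsLo / 8)) (hst : s < t) (hα : b.alphaLo κ t < 1) :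
    b.psiLo κ lam₀ t < b.psiLo κ lam₀ s := by
  have hκ := HU.cone.spike.κ_pos
  have h1 : b.alphaLo κ s < b.alphaLo κ t := b.strictMonoOn_alphaLo hκ hs ht hst
  exact strictAntiOn_spikeScalar (cOne_mem hl) (show b.alphaLo κ s ∈ Iio (1:ℝ) by simp; linarith) (show b.alphaLo κ t ∈ Iio (1:ℝ) from hα) h1

include HU hl in
/-- Monotonicity of the upper ray scalar: for upper core parameters `s < t` with `αHi s < 1`,
`ψHi s < ψHi t`. [folklore] -/
theorem psiHi_lt_psiHi {s t : ℝ} (hs : s ∈ Icc (b.tcHi - b.epsHi / 8) (b.tcHi + b.epsHi / 8))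
    (ht : t ∈ Icc (b.tcHi - b.epsHi / 8) (b.tcHi + b.epsHi / 8)) (hst : s < t) (hα : b.alphaHi κ s < 1) :
    b.psiHi κ lam₀ s < b.psiHi κ lam₀ t := by
  have hκ := HU.cone.spike.κ_pos
  have h1 : b.alphaHi κ t < b.alphaHi κ s := b.strictAntiOn_alphaHi hκ hs ht hst
  exact strictAntiOn_spikeScalar (cOne_mem hl) (show b.alphaHi κ t ∈ Iio (1:ℝ) by simp; linarith) (show b.alphaHi κ s ∈ Iio (1:ℝ) from hα) h1

include hl2 in
/-- **Ordering of lower clock points**: larger values come first. [folklore] -/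
theorem clockLo_lt_clockLo {v v' : ℝ} (hv : v ∈ Icc (1 / 4 : ℝ) (1 / 2)) (hv' : v' ∈ Icc (1 / 4 : ℝ) (1 / 2)) (h : v' < v) :
    b.clockLo HU hl hv < b.clockLo HU hl hv' := by
  by_contra hle
  push Not at hle
  have e := (b.clockLo_spec HU hl hv).2
  have e' := (b.clockLo_spec HU hl hv').2
  rcases hle.lt_or_eq with hlt | heq
  · have := b.psiLo_lt_psiLo HU hl (b.clockLo_mem_core HU hl hv') (b.clockLo_mem_core HU hl hv) hlt
      (by linarith [(b.alphaLo_clockLo_mem HU hl hl2 hv).2])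
    linarith
  · rw [heq] at e'; linarith

include hl2 in
/-- **Ordering of upper clock points**: larger values come last. [folklore] -/
theorem clockHi_lt_clockHi {v v' : ℝ} (hv : v ∈ Icc (1 / 4 : ℝ) (1 / 2)) (hv' : v' ∈ Icc (1 / 4 : ℝ) (1 / 2)) (h : v < v') :
    b.clockHi HU hl hv < b.clockHi HU hl hv' := by
  by_contra hle
  push Not at hle
  have e := (b.clockHi_spec HU hl hv).2
  have e' := (b.clockHi_spec HU hl hv').2
  rcases hle.lt_or_eq with hlt | heq
  · have := b.psiHi_lt_psiHi HU hl (b.clockHi_mem_core HU hl hv') (b.clockHi_mem_core HU hl hv) hlt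
      (by linarith [(b.alphaHi_clockHi_mem HU hl hl2 hv').2])
    linarith
  · rw [heq] at e'; linarith

/-- Every lower clock point precedes every upper clock point. [folklore] -/
theorem clockLo_lt_clockHi {v v' : ℝ} (hv : v ∈ Icc (1 / 4 : ℝ) (1 / 2)) (hv' : v' ∈ Icc (1 / 4 : ℝ) (1 / 2)) :
    b.clockLo HU hl hv < b.clockHi HU hl hv' := by
  have h1 := (b.clockLo_mem_core HU hl hv).2
  have h2 := (b.clockHi_mem_core HU hl hv').1
  linarith [b.coreLo_lt_coreHi]

include hl2 in
/-- The lower ray scalar left of a lower clock point (in the core) exceeds its value. [folklore] -/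
theorem lt_psiLo_of_lt_clockLo {v : ℝ} (hv : v ∈ Icc (1 / 4 : ℝ) (1 / 2)) {t : ℝ}
    (ht : t ∈ Icc (b.tcLo - b.epsLo / 8) (b.tcLo + b.epsLo / 8)) (hlt : t < b.clockLo HU hl hv) : v < b.psiLo κ lam₀ t := by
  have := b.psiLo_lt_psiLo HU hl ht (b.clockLo_mem_core HU hl hv) hlt (by linarith [(b.alphaLo_clockLo_mem HU hl hl2 hv).2])
  rwa [(b.clockLo_spec HU hl hv).2] at this

include hl2 in
/-- The upper ray scalar right of an upper clock point (in the core) exceeds its value. [folklore] -/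
theorem lt_psiHi_of_clockHi_lt {v : ℝ} (hv : v ∈ Icc (1 / 4 : ℝ) (1 / 2)) {t : ℝ}
    (ht : t ∈ Icc (b.tcHi - b.epsHi / 8) (b.tcHi + b.epsHi / 8)) (hlt : b.clockHi HU hl hv < t) : v < b.psiHi κ lam₀ t := by
  have := b.psiHi_lt_psiHi HU hl (b.clockHi_mem_core HU hl hv) ht hlt (by linarith [(b.alphaHi_clockHi_mem HU hl hl2 hv).2])
  rwa [(b.clockHi_spec HU hl hv).2] at this

include hl2 in
/-- Between two lower clock points the lower ray scalar lies between their values. [folklore] -/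
theorem psiLo_mem_of_mem {v v' : ℝ} (hv : v ∈ Icc (1 / 4 : ℝ) (1 / 2)) (hv' : v' ∈ Icc (1 / 4 : ℝ) (1 / 2)) {t : ℝ}
    (ht : t ∈ Icc (b.clockLo HU hl hv) (b.clockLo HU hl hv')) : b.psiLo κ lam₀ t ∈ Icc v' v := by
  have hc1 := b.clockLo_mem_core HU hl hv
  have hc2 := b.clockLo_mem_core HU hl hv'
  have htc : t ∈ Icc (b.tcLo - b.epsLo / 8) (b.tcLo + b.epsLo / 8) := ⟨by linarith [ht.1, hc1.1], by linarith [ht.2, hc2.2]⟩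
  have hκ := HU.cone.spike.κ_pos
  have hαt : b.alphaLo κ t < 1 := by
    have := (b.strictMonoOn_alphaLo hκ).monotoneOn htc hc2 ht.2
    linarith [(b.alphaLo_clockLo_mem HU hl hl2 hv').2]
  constructor
  · rcases ht.2.lt_or_eq with hlt | heq
    · exact (b.lt_psiLo_of_lt_clockLo HU hl hl2 hv' htc hlt).le
    · rw [heq, (b.clockLo_spec HU hl hv').2]
  · rcases ht.1.lt_or_eq with hlt | heq
    · have := b.psiLo_lt_psiLo HU hl hc1 htc hlt hαt
      rw [(b.clockLo_spec HU hl hv).2] at this; exact this.le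
    · rw [← heq, (b.clockLo_spec HU hl hv).2]

include hl2 in
/-- Between two upper clock points the upper ray scalar lies between their values. [folklore] -/
theorem psiHi_mem_of_mem {v v' : ℝ} (hv : v ∈ Icc (1 / 4 : ℝ) (1 / 2)) (hv' : v' ∈ Icc (1 / 4 : ℝ) (1 / 2)) {t : ℝ}
    (ht : t ∈ Icc (b.clockHi HU hl hv) (b.clockHi HU hl hv')) : b.psiHi κ lam₀ t ∈ Icc v v' := by
  have hc1 := b.clockHi_mem_core HU hl hv
  have hc2 := b.clockHi_mem_core HU hl hv'
  have htc : t ∈ Icc (b.tcHi - b.epsHi / 8) (b.tcHi + b.epsHi / 8) := ⟨by linarith [ht.1, hc1.1], by linarith [ht.2, hc2.2]⟩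
  have hκ := HU.cone.spike.κ_pos
  have hαt : b.alphaHi κ t < 1 := by
    have := (b.strictAntiOn_alphaHi hκ).antitoneOn hc1 htc ht.1
    linarith [(b.alphaHi_clockHi_mem HU hl hl2 hv).2]
  constructor
  · rcases ht.1.lt_or_eq with hlt | heq
    · exact (b.lt_psiHi_of_clockHi_lt HU hl hl2 hv htc hlt).le
    · rw [← heq, (b.clockHi_spec HU hl hv).2]
  · rcases ht.2.lt_or_eq with hlt | heq
    · have := b.psiHi_lt_psiHi HU hl htc hc2 hlt hαt
      rw [(b.clockHi_spec HU hl hv').2] at this; exact this.le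
    · rw [heq, (b.clockHi_spec HU hl hv').2]

include hl2 in
/-- The blown-up parameter between the first lower clock point and any parameter of the lower core
right of it, up to a later clock point, stays below `3/4`. [folklore] -/
theorem alphaLo_lt_of_le_clockLo {v : ℝ} (hv : v ∈ Icc (1 / 4 : ℝ) (1 / 2)) {t : ℝ}
    (ht : t ∈ Icc (b.tcLo - b.epsLo / 8) (b.tcLo + b.epsLo / 8)) (hle : t ≤ b.clockLo HU hl hv) : b.alphaLo κ t < 3 / 4 := by
  have := (b.strictMonoOn_alphaLo HU.cone.spike.κ_pos).monotoneOn ht (b.clockLo_mem_core HU hl hv) hle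
  linarith [(b.alphaLo_clockLo_mem HU hl hl2 hv).2]

include hl2 in
/-- The blown-up parameter right of an upper clock point (in the core) stays below `3/4`. [folklore] -/
theorem alphaHi_lt_of_clockHi_le {v : ℝ} (hv : v ∈ Icc (1 / 4 : ℝ) (1 / 2)) {t : ℝ}
    (ht : t ∈ Icc (b.tcHi - b.epsHi / 8) (b.tcHi + b.epsHi / 8)) (hle : b.clockHi HU hl hv ≤ t) : b.alphaHi κ t < 3 / 4 := by
  have := (b.strictAntiOn_alphaHi HU.cone.spike.κ_pos).antitoneOn (b.clockHi_mem_core HU hl hv) ht hle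
  linarith [(b.alphaHi_clockHi_mem HU hl hl2 hv).2]

/-! ### The window and the clock -/

/-- `1/2 ∈ [1/4, 1/2]`. [folklore] -/
theorem half_mem_Icc : (1 / 2 : ℝ) ∈ Icc (1 / 4 : ℝ) (1 / 2) := by norm_num
/-- `3/8 ∈ [1/4, 1/2]`. [folklore] -/
theorem three_eighths_mem_Icc : (3 / 8 : ℝ) ∈ Icc (1 / 4 : ℝ) (1 / 2) := by norm_num
/-- `1/4 ∈ [1/4, 1/2]`. [folklore] -/
theorem quarter_mem_Icc : (1 / 4 : ℝ) ∈ Icc (1 / 4 : ℝ) (1 / 2) := by norm_num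

/-- **The left end of the window** `w₁`: lower ray scalar `1/2`. [folklore] -/
def winLo : ℝ := b.clockLo HU hl half_mem_Icc
/-- **The left collar point** `p₁`: lower ray scalar `3/8`. [folklore] -/
def collarLo : ℝ := b.clockLo HU hl three_eighths_mem_Icc
/-- **The left inner point** `p₂`: lower ray scalar `1/4`. [folklore] -/
def innerLo : ℝ := b.clockLo HU hl quarter_mem_Icc
/-- **The right inner point** `p₄`: upper ray scalar `1/4`. [folklore] -/
def innerHi : ℝ := b.clockHi HU hl quarter_mem_Icc
/-- **The right collar point** `p₅`: upper ray scalar `3/8`. [folklore] -/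
def collarHi : ℝ := b.clockHi HU hl three_eighths_mem_Icc
/-- **The right end of the window** `w₂`: upper ray scalar `1/2`. [folklore] -/
def winHi : ℝ := b.clockHi HU hl half_mem_Icc

/-- `w₁` lies in the closed lower core. [folklore] -/
theorem winLo_mem_core : b.winLo HU hl ∈ Icc (b.tcLo - b.epsLo / 8) (b.tcLo + b.epsLo / 8) := b.clockLo_mem_core HU hl _
/-- `p₁` lies in the closed lower core. [folklore] -/
theorem collarLo_mem_core : b.collarLo HU hl ∈ Icc (b.tcLo - b.epsLo / 8) (b.tcLo + b.epsLo / 8) := b.clockLo_mem_core HU hl _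
/-- `p₂` lies in the closed lower core. [folklore] -/
theorem innerLo_mem_core : b.innerLo HU hl ∈ Icc (b.tcLo - b.epsLo / 8) (b.tcLo + b.epsLo / 8) := b.clockLo_mem_core HU hl _
/-- `p₄` lies in the closed upper core. [folklore] -/
theorem innerHi_mem_core : b.innerHi HU hl ∈ Icc (b.tcHi - b.epsHi / 8) (b.tcHi + b.epsHi / 8) := b.clockHi_mem_core HU hl _
/-- `p₅` lies in the closed upper core. [folklore] -/
theorem collarHi_mem_core : b.collarHi HU hl ∈ Icc (b.tcHi - b.epsHi / 8) (b.tcHi + b.epsHi / 8) := b.clockHi_mem_core HU hl _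
/-- `w₂` lies in the closed upper core. [folklore] -/
theorem winHi_mem_core : b.winHi HU hl ∈ Icc (b.tcHi - b.epsHi / 8) (b.tcHi + b.epsHi / 8) := b.clockHi_mem_core HU hl _

include hl2 in
/-- `w₁ < p₁`. [folklore] -/
theorem winLo_lt_collarLo : b.winLo HU hl < b.collarLo HU hl := b.clockLo_lt_clockLo HU hl hl2 _ _ (by norm_num)
include hl2 in
/-- `p₁ < p₂`. [folklore] -/
theorem collarLo_lt_innerLo : b.collarLo HU hl < b.innerLo HU hl := b.clockLo_lt_clockLo HU hl hl2 _ _ (by norm_num)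
/-- `p₂ < p₄`. [folklore] -/
theorem innerLo_lt_innerHi : b.innerLo HU hl < b.innerHi HU hl := b.clockLo_lt_clockHi HU hl _ _
include hl2 in
/-- `p₄ < p₅`. [folklore] -/
theorem innerHi_lt_collarHi : b.innerHi HU hl < b.collarHi HU hl := b.clockHi_lt_clockHi HU hl hl2 _ _ (by norm_num)
include hl2 in
/-- `p₅ < w₂`. [folklore] -/
theorem collarHi_lt_winHi : b.collarHi HU hl < b.winHi HU hl := b.clockHi_lt_clockHi HU hl hl2 _ _ (by norm_num)

/-- **The middle slope function** `m(s) = -1/4 + (s - p₁) (1/2)/(p₅ - p₁)`: `-1/4` at `p₁`, `1/4`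
at `p₅`. [folklore] -/
def slopeFn (s : ℝ) : ℝ := -(1 / 4) + (s - b.collarLo HU hl) * ((1 / 2) / (b.collarHi HU hl - b.collarLo HU hl))

include hl2 in
/-- `p₁ < p₅`. [folklore] -/
theorem collarLo_lt_collarHi : b.collarLo HU hl < b.collarHi HU hl := by
  linarith [b.collarLo_lt_innerLo HU hl hl2, b.innerLo_lt_innerHi HU hl, b.innerHi_lt_collarHi HU hl hl2]

/-- The middle slope function is `C^∞`. [folklore] -/
theorem contDiff_slopeFn : ContDiff ℝ ∞ (b.slopeFn HU hl) :=
  contDiff_const.add ((contDiff_id.sub contDiff_const).mul contDiff_const)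

include hl2 in
/-- The middle slope function has positive (constant) derivative. [folklore] -/
theorem deriv_slopeFn_pos (s : ℝ) : 0 < deriv (b.slopeFn HU hl) s := by
  have hpos : 0 < (1 / 2) / (b.collarHi HU hl - b.collarLo HU hl) := div_pos (by norm_num) (by linarith [b.collarLo_lt_collarHi HU hl hl2])
  have hd : HasDerivAt (b.slopeFn HU hl) ((1 : ℝ) * ((1 / 2) / (b.collarHi HU hl - b.collarLo HU hl))) s :=
    (((hasDerivAt_id' s).sub_const (b.collarLo HU hl)).mul_const ((1 / 2) / (b.collarHi HU hl - b.collarLo HU hl))).const_add (-(1 / 4 : ℝ))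
  rw [hd.deriv]; linarith

include hl2 in
/-- On `[p₁, ∞)` the middle slope function is `≥ -1/4`; on `(-∞, p₅]` it is `≤ 1/4`. [folklore] -/
theorem slopeFn_bounds (s : ℝ) : (b.collarLo HU hl ≤ s → -(1 / 4) ≤ b.slopeFn HU hl s) ∧ (s ≤ b.collarHi HU hl → b.slopeFn HU hl s ≤ 1 / 4) := by
  have hcc := b.collarLo_lt_collarHi HU hl hl2
  have hpos : 0 < (1 / 2) / (b.collarHi HU hl - b.collarLo HU hl) := div_pos (by norm_num) (by linarith)
  constructor
  · intro hs
    rw [slopeFn]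
    nlinarith
  · intro hs
    rw [slopeFn]
    have h1 : (s - b.collarLo HU hl) * ((1 / 2) / (b.collarHi HU hl - b.collarLo HU hl)) ≤
        (b.collarHi HU hl - b.collarLo HU hl) * ((1 / 2) / (b.collarHi HU hl - b.collarLo HU hl)) :=
      mul_le_mul_of_nonneg_right (by linarith) hpos.le
    rw [mul_div_cancel₀ _ (by linarith : b.collarHi HU hl - b.collarLo HU hl ≠ 0)] at h1
    linarith

include hl2 in
/-- **Existence of the clock**: a `C^∞` function equal to `-ψLo` left of `p₁`, to `ψHi` right of
`p₅`, with positive derivative on the window `[w₁, w₂]` (two monotone blendings through the middle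
slope function). [folklore] -/
theorem exists_clockFn : ∃ rf : ℝ → ℝ, ContDiff ℝ ∞ rf ∧ (∀ s, s ≤ b.collarLo HU hl → rf s = -b.psiLo κ lam₀ s) ∧
    (∀ s, b.collarHi HU hl ≤ s → rf s = b.psiHi κ lam₀ s) ∧ ∀ s ∈ Icc (b.winLo HU hl) (b.winHi HU hl), 0 < deriv rf s := by
  have hκ := HU.cone.spike.κ_pos
  have h12 := b.winLo_lt_collarLo HU hl hl2
  have h23 := b.collarLo_lt_innerLo HU hl hl2
  have h34 := b.innerLo_lt_innerHi HU hl
  have h45 := b.innerHi_lt_collarHi HU hl hl2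
  have h56 := b.collarHi_lt_winHi HU hl hl2
  -- derivative of `-ψLo` on the lower strict zone, of `ψHi` on the upper strict zone
  have dLo : ∀ s ∈ Icc (b.tcLo - b.epsLo / 8) (b.tcLo + b.epsLo / 8), s ≤ b.innerLo HU hl →
      0 < deriv (fun s ↦ -b.psiLo κ lam₀ s) s := fun s hs hle ↦ by
    obtain ⟨D, hD, hd⟩ := b.hasDerivAt_psiLo_neg hl hκ hs (by linarith [b.alphaLo_lt_of_le_clockLo HU hl hl2 _ hs hle])
    rw [deriv.fun_neg, hd.deriv]; linarith
  have dHi : ∀ s ∈ Icc (b.tcHi - b.epsHi / 8) (b.tcHi + b.epsHi / 8), b.innerHi HU hl ≤ s →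
      0 < deriv (b.psiHi κ lam₀) s := fun s hs hle ↦ by
    obtain ⟨D, hD, hd⟩ := b.hasDerivAt_psiHi_pos hl hκ hs (by linarith [b.alphaHi_lt_of_clockHi_le HU hl hl2 _ hs hle])
    rw [hd.deriv]; exact hD
  have coreLo_of : ∀ {s}, s ∈ Icc (b.winLo HU hl) (b.innerLo HU hl) → s ∈ Icc (b.tcLo - b.epsLo / 8) (b.tcLo + b.epsLo / 8) :=
    fun hs ↦ ⟨by linarith [hs.1, (b.winLo_mem_core HU hl).1], by linarith [hs.2, (b.innerLo_mem_core HU hl).2]⟩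
  have coreHi_of : ∀ {s}, s ∈ Icc (b.innerHi HU hl) (b.winHi HU hl) → s ∈ Icc (b.tcHi - b.epsHi / 8) (b.tcHi + b.epsHi / 8) :=
    fun hs ↦ ⟨by linarith [hs.1, (b.innerHi_mem_core HU hl).1], by linarith [hs.2, (b.winHi_mem_core HU hl).2]⟩
  -- first blending: `-ψLo` with the slope function over `[p₁, p₂]`
  obtain ⟨H₁, hH₁s, hH₁l, hH₁r, hH₁d, -⟩ := exists_blend_deriv_pos h23 ((b.contDiff_psiLo κ lam₀).neg) (b.contDiff_slopeFn HU hl)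
    (fun s hs ↦ by
      have hψ := b.psiLo_mem_of_mem HU hl hl2 three_eighths_mem_Icc quarter_mem_Icc (t := s) hs
      linarith [hψ.1, (b.slopeFn_bounds HU hl hl2 s).1 hs.1])
    (fun s hs ↦ dLo s (coreLo_of ⟨by linarith [hs.1], hs.2⟩) hs.2)
    (fun s' _ ↦ b.deriv_slopeFn_pos HU hl hl2 s')
  -- second blending: `H₁` with `ψHi` over `[p₄, p₅]`
  have hH₁eq : ∀ s, b.innerLo HU hl ≤ s → H₁ s = b.slopeFn HU hl s := hH₁r
  obtain ⟨H₂, hH₂s, hH₂l, hH₂r, hH₂d, -⟩ := exists_blend_deriv_pos h45 hH₁s (b.contDiff_psiHi κ lam₀)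
    (fun s hs ↦ by
      rw [hH₁eq s (by linarith [hs.1])]
      have hψ := b.psiHi_mem_of_mem HU hl hl2 quarter_mem_Icc three_eighths_mem_Icc (t := s) hs
      linarith [hψ.1, (b.slopeFn_bounds HU hl hl2 s).2 hs.2])
    (fun s hs ↦ by
      have hev : H₁ =ᶠ[𝓝 s] b.slopeFn HU hl := by
        filter_upwards [Ioi_mem_nhds (show b.innerLo HU hl < s by linarith [hs.1])] with s' hs' using hH₁eq s' hs'.le
      rw [hev.deriv_eq]; exact b.deriv_slopeFn_pos HU hl hl2 s)
    (fun s hs ↦ dHi s (coreHi_of ⟨hs.1, by linarith [hs.2]⟩) hs.1)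
  refine ⟨H₂, hH₂s, fun s hs ↦ ?_, hH₂r, fun s hs ↦ ?_⟩
  · rw [hH₂l s (by linarith), hH₁l s hs]
  · -- positivity of the derivative on the window, region by region
    rcases lt_or_ge s (b.collarLo HU hl) with h1 | h1
    · -- left collar: `H₂ = -ψLo` near `s`
      have hev : H₂ =ᶠ[𝓝 s] fun s ↦ -b.psiLo κ lam₀ s := by
        filter_upwards [Iio_mem_nhds h1] with s' hs'
        rw [hH₂l s' (by linarith [hs'.out]), hH₁l s' hs'.out.le]
      rw [hev.deriv_eq]
      exact dLo s (coreLo_of ⟨hs.1, by linarith⟩) (by linarith)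
    rcases le_or_gt s (b.innerLo HU hl) with h2 | h2
    · -- first blending zone: `H₂ = H₁` near `s`
      have hev : H₂ =ᶠ[𝓝 s] H₁ := by
        filter_upwards [Iio_mem_nhds (show s < b.innerHi HU hl by linarith)] with s' hs' using hH₂l s' hs'.out.le
      rw [hev.deriv_eq]; exact hH₁d s ⟨h1, h2⟩
    rcases lt_or_ge s (b.innerHi HU hl) with h3 | h3
    · -- middle: `H₂ = slopeFn` near `s`
      have hev : H₂ =ᶠ[𝓝 s] b.slopeFn HU hl := by
        filter_upwards [Iio_mem_nhds h3, Ioi_mem_nhds h2] with s' hs' hs''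
        rw [hH₂l s' hs'.out.le, hH₁eq s' hs''.out.le]
      rw [hev.deriv_eq]; exact b.deriv_slopeFn_pos HU hl hl2 s
    rcases le_or_gt s (b.collarHi HU hl) with h4 | h4
    · exact hH₂d s ⟨h3, h4⟩
    · -- right collar: `H₂ = ψHi` near `s`
      have hev : H₂ =ᶠ[𝓝 s] b.psiHi κ lam₀ := by
        filter_upwards [Ioi_mem_nhds h4] with s' hs' using hH₂r s' hs'.out.le
      rw [hev.deriv_eq]
      exact dHi s (coreHi_of ⟨by linarith, hs.2⟩) (by linarith)

/-- **The clock** of the host on the window. [folklore] -/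
def clockFn : ℝ → ℝ := (b.exists_clockFn HU hl hl2).choose

/-- The clock is `C^∞`. [folklore] -/
theorem contDiff_clockFn : ContDiff ℝ ∞ (b.clockFn HU hl hl2) := (b.exists_clockFn HU hl hl2).choose_spec.1

/-- Left of `p₁` the clock is `-ψLo`. [folklore] -/
theorem clockFn_of_le_collarLo {s : ℝ} (hs : s ≤ b.collarLo HU hl) : b.clockFn HU hl hl2 s = -b.psiLo κ lam₀ s :=
  (b.exists_clockFn HU hl hl2).choose_spec.2.1 s hs

/-- Right of `p₅` the clock is `ψHi`. [folklore] -/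
theorem clockFn_of_collarHi_le {s : ℝ} (hs : b.collarHi HU hl ≤ s) : b.clockFn HU hl hl2 s = b.psiHi κ lam₀ s :=
  (b.exists_clockFn HU hl hl2).choose_spec.2.2.1 s hs

/-- The clock has positive derivative on the window. [folklore] -/
theorem deriv_clockFn_pos {s : ℝ} (hs : s ∈ Icc (b.winLo HU hl) (b.winHi HU hl)) : 0 < deriv (b.clockFn HU hl hl2) s :=
  (b.exists_clockFn HU hl hl2).choose_spec.2.2.2 s hs

/-- **The clock is strictly increasing on the window.** [folklore] -/
theorem strictMonoOn_clockFn : StrictMonoOn (b.clockFn HU hl hl2) (Icc (b.winLo HU hl) (b.winHi HU hl)) :=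
  strictMonoOn_of_deriv_pos (convex_Icc _ _) (b.contDiff_clockFn HU hl hl2).continuous.continuousOn
    (fun _ hs ↦ b.deriv_clockFn_pos HU hl hl2 (interior_subset hs))

/-- The clock at `w₁` is `-1/2`. [folklore] -/
theorem clockFn_winLo : b.clockFn HU hl hl2 (b.winLo HU hl) = -(1 / 2) := by
  rw [b.clockFn_of_le_collarLo HU hl hl2 (b.winLo_lt_collarLo HU hl hl2).le, winLo, (b.clockLo_spec HU hl half_mem_Icc).2]

/-- The clock at `w₂` is `1/2`. [folklore] -/
theorem clockFn_winHi : b.clockFn HU hl hl2 (b.winHi HU hl) = 1 / 2 := by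
  rw [b.clockFn_of_collarHi_le HU hl hl2 (b.collarHi_lt_winHi HU hl hl2).le, winHi, (b.clockHi_spec HU hl half_mem_Icc).2]

/-- On the window the clock takes values in `[-1/2, 1/2]`. [folklore] -/
theorem clockFn_mem {s : ℝ} (hs : s ∈ Icc (b.winLo HU hl) (b.winHi HU hl)) : b.clockFn HU hl hl2 s ∈ Icc (-(1 / 2) : ℝ) (1 / 2) := by
  have hmono := (b.strictMonoOn_clockFn HU hl hl2).monotoneOn
  have hw : b.winLo HU hl ≤ b.winHi HU hl := hs.1.trans hs.2
  constructor
  · rw [← b.clockFn_winLo HU hl hl2]; exact hmono ⟨le_rfl, hw⟩ hs hs.1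
  · rw [← b.clockFn_winHi HU hl hl2]; exact hmono hs ⟨hw, le_rfl⟩ hs.2

include hl2 in
/-- The window lies in the content set. [folklore] -/
theorem window_subset_contentSet : Icc (b.winLo HU hl) (b.winHi HU hl) ⊆
    b.contentSet HU.cone.spike.κ_pos HU.cone.spike.seven_le_gapLo HU.cone.spike.seven_le_gapHi := by
  intro s hs
  have h1 := b.clockLo_mem_contentSet HU hl hl2 half_mem_Icc
  have h2 := b.clockHi_mem_contentSet HU hl hl2 half_mem_Icc
  exact ⟨h1.1.trans hs.1, hs.2.trans h2.2⟩

/-! ### The host -/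

variable {F : ℝ → 𝔼 4} (hW : b.IsWallFrame HU.cone F) {rA : ℝ} (hrA : 0 < rA) (hrA8 : rA ≤ 1 / 8)
  (hB : B.InSouth) (hAB : Disjoint (range A) (range B))

/-- **The straight piece**: `ψ⁻¹ (blowDown (O + r(s) dLo))` along the clock. [folklore] -/
def straightPt (s : ℝ) : 𝔼 4 :=
  ((psiN.symm (b.blowDown hcross κ (cO b.depthSign + b.clockFn HU hl hl2 s • dLo b.depthSign)) : 𝕊 3) : 𝔼 4)

/-- **The window plateau** `θ_W`: `1` on `[p₁, p₅]`, `0` off `(w₁, w₂)`. [folklore] -/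
def winCut (s : ℝ) : ℝ :=
  smoothStep (b.winLo HU hl) (b.collarLo HU hl) s * (1 - smoothStep (b.collarHi HU hl) (b.winHi HU hl) s)

/-- **The host piece function**: the curve of the bent knot, replaced on the window by the straight
piece. [folklore] -/
def hostPiece (s : ℝ) : 𝔼 4 :=
  Knot.curve (b.bentKnot HU hW hl hrA hB hAB) s +
    b.winCut HU hl s • (b.straightPt HU hl hl2 s - Knot.curve (b.bentKnot HU hW hl hrA hB hAB) s)

/-- The straight piece is `C^∞`. [folklore] -/
theorem contDiff_straightPt : ContDiff ℝ ∞ (b.straightPt HU hl hl2) :=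
  contDiff_coe_psiN_symm.comp ((b.contDiff_blowDown hcross κ).comp
    (contDiff_const.add ((b.contDiff_clockFn HU hl hl2).smul contDiff_const)))

/-- The window plateau is `C^∞`. [folklore] -/
theorem contDiff_winCut : ContDiff ℝ ∞ (b.winCut HU hl) :=
  (contDiff_smoothStep _ _).mul (contDiff_const.sub (contDiff_smoothStep _ _))

/-- **The host piece function is `C^∞`.** [folklore] -/
theorem contDiff_hostPiece : ContDiff ℝ ∞ (b.hostPiece HU hl hl2 hW hrA hB hAB) :=
  (Knot.contDiff_curve _).add ((b.contDiff_winCut HU hl).smul ((b.contDiff_straightPt HU hl hl2).sub (Knot.contDiff_curve _)))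

include hl2 in
/-- Off `(w₁, w₂)` the window plateau vanishes. [folklore] -/
theorem winCut_of_not_mem {s : ℝ} (hs : s ∉ Ioo (b.winLo HU hl) (b.winHi HU hl)) : b.winCut HU hl s = 0 := by
  rw [mem_Ioo, not_and_or, not_lt, not_lt] at hs
  rcases hs with h | h
  · rw [winCut, smoothStep_of_le (b.winLo_lt_collarLo HU hl hl2) h, zero_mul]
  · rw [winCut, smoothStep_of_ge (b.collarHi_lt_winHi HU hl hl2) h]; ring

include hl2 in
/-- On `[p₁, p₅]` the window plateau is `1`. [folklore] -/
theorem winCut_of_mem {s : ℝ} (hs : s ∈ Icc (b.collarLo HU hl) (b.collarHi HU hl)) : b.winCut HU hl s = 1 := by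
  rw [winCut, smoothStep_of_ge (b.winLo_lt_collarLo HU hl hl2) hs.1, smoothStep_of_le (b.collarHi_lt_winHi HU hl hl2) hs.2]; ring

include HU in
/-- The lower ray point as a blow-down: `oS + ψ (blowDown baseLo - oS) = blowDown (O + (-ψ) dLo)`. [folklore] -/
theorem rayLo_eq_blowDown (ψ : ℝ) :
    b.oS hcross κ b.depthSign + ψ • (b.blowDown hcross κ (pt3 (1 / 4) (-1) 0) - b.oS hcross κ b.depthSign) =
      b.blowDown hcross κ (cO b.depthSign + (-ψ) • dLo b.depthSign) := by
  have e : (pt3 (1 - 3 * ψ / 4) (-ψ) (b.depthSign * (1 - ψ)) : 𝔼 3) = cO b.depthSign + (-ψ) • dLo b.depthSign := by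
    rw [rayLo_eq, neg_smul, sub_eq_add_neg]
  rw [← e, ← b.blowUp_rayLo HU.cone ψ, b.blowDown_blowUp hcross HU.cone.spike.κ_pos.ne']

/-- **On the left collar `[w₁, p₁]` the bent knot is the straight piece.** [folklore] -/
theorem curve_eq_straightPt_of_mem_left {s : ℝ} (hs : s ∈ Icc (b.winLo HU hl) (b.collarLo HU hl)) :
    Knot.curve (b.bentKnot HU hW hl hrA hB hAB) s = b.straightPt HU hl hl2 s := by
  have hκ := HU.cone.spike.κ_pos
  have hcore : s ∈ Icc (b.tcLo - b.epsLo / 8) (b.tcLo + b.epsLo / 8) :=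
    ⟨by linarith [hs.1, (b.winLo_mem_core HU hl).1], by linarith [hs.2, (b.collarLo_mem_core HU hl).2]⟩
  have hα1 : 3 / 8 ≤ b.alphaLo κ s := by
    have := (b.strictMonoOn_alphaLo hκ).monotoneOn (b.winLo_mem_core HU hl) hcore hs.1
    have h38 : 3 / 8 < b.alphaLo κ (b.winLo HU hl) := (b.alphaLo_clockLo_mem HU hl hl2 half_mem_Icc).1
    linarith
  have hα2 : b.alphaLo κ s < 3 / 4 := b.alphaLo_lt_of_le_clockLo HU hl hl2 _ hcore hs.2
  rw [Knot.curve_apply, b.bentKnot_circlePt_lowerSpike HU hW hl hrA hB hAB hcore ⟨hα1, hα2.le⟩, straightPt,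
    b.clockFn_of_le_collarLo HU hl hl2 hs.2, psiLo, b.rayLo_eq_blowDown HU]

include hrA8 in
/-- **On the right collar `[p₅, w₂]` the bent knot is the straight piece** (`r_A ≤ 1/8`). [folklore] -/
theorem curve_eq_straightPt_of_mem_right {s : ℝ} (hs : s ∈ Icc (b.collarHi HU hl) (b.winHi HU hl)) :
    Knot.curve (b.bentKnot HU hW hl hrA hB hAB) s = b.straightPt HU hl hl2 s := by
  have hκ := HU.cone.spike.κ_pos
  have hcore : s ∈ Icc (b.tcHi - b.epsHi / 8) (b.tcHi + b.epsHi / 8) :=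
    ⟨by linarith [hs.1, (b.collarHi_mem_core HU hl).1], by linarith [hs.2, (b.winHi_mem_core HU hl).2]⟩
  have hα1 : 3 / 8 ≤ b.alphaHi κ s := by
    have := (b.strictAntiOn_alphaHi hκ).antitoneOn hcore (b.winHi_mem_core HU hl) hs.2
    have h38 : 3 / 8 < b.alphaHi κ (b.winHi HU hl) := (b.alphaHi_clockHi_mem HU hl hl2 half_mem_Icc).1
    linarith
  have hα2 : b.alphaHi κ s < 3 / 4 := b.alphaHi_lt_of_clockHi_le HU hl hl2 _ hcore hs.1
  have hψ := b.psiHi_mem_of_mem HU hl hl2 three_eighths_mem_Icc half_mem_Icc (t := s) hs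
  rw [Knot.curve_apply, b.bentKnot_circlePt_upperSpike_of_mem HU hW hl hrA (by linarith) hB hAB hcore ⟨hα1, hα2.le⟩
    ⟨by rw [← psiHi]; linarith [hψ.1], by rw [← psiHi]; exact hψ.2⟩, straightPt, b.clockFn_of_collarHi_le HU hl hl2 hs.1, psiHi]

/-- **Off the window the host is the bent knot.** [folklore] -/
theorem hostPiece_eq_curve_of_not_mem {s : ℝ} (hs : s ∉ Ioo (b.winLo HU hl) (b.winHi HU hl)) :
    b.hostPiece HU hl hl2 hW hrA hB hAB s = Knot.curve (b.bentKnot HU hW hl hrA hB hAB) s := by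
  rw [hostPiece, b.winCut_of_not_mem HU hl hl2 hs, zero_smul, add_zero]

include hrA8 in
/-- **On the window the host is the straight piece.** [folklore] -/
theorem hostPiece_eq_straightPt_of_mem {s : ℝ} (hs : s ∈ Icc (b.winLo HU hl) (b.winHi HU hl)) :
    b.hostPiece HU hl hl2 hW hrA hB hAB s = b.straightPt HU hl hl2 s := by
  rw [hostPiece]
  rcases le_or_gt s (b.collarLo HU hl) with h1 | h1
  · rw [b.curve_eq_straightPt_of_mem_left HU hl hl2 hW hrA hB hAB ⟨hs.1, h1⟩, sub_self, smul_zero, add_zero]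
  rcases lt_or_ge s (b.collarHi HU hl) with h2 | h2
  · rw [b.winCut_of_mem HU hl hl2 ⟨h1.le, h2.le⟩, one_smul, add_sub_cancel]
  · rw [b.curve_eq_straightPt_of_mem_right HU hl hl2 hW hrA hrA8 hB hAB ⟨h2, hs.2⟩, sub_self, smul_zero, add_zero]

include hrA8 in
/-- **Off the open collar interval `(p₁, p₅)` the host is the bent knot.** [folklore] -/
theorem hostPiece_eq_curve_of_not_mem_collar {s : ℝ} (hs : s ∉ Ioo (b.collarLo HU hl) (b.collarHi HU hl)) :
    b.hostPiece HU hl hl2 hW hrA hB hAB s = Knot.curve (b.bentKnot HU hW hl hrA hB hAB) s := by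
  by_cases hw : s ∈ Ioo (b.winLo HU hl) (b.winHi HU hl)
  · rw [b.hostPiece_eq_straightPt_of_mem HU hl hl2 hW hrA hrA8 hB hAB (Ioo_subset_Icc_self hw)]
    rw [mem_Ioo, not_and_or, not_lt, not_lt] at hs
    rcases hs with h | h
    · exact (b.curve_eq_straightPt_of_mem_left HU hl hl2 hW hrA hB hAB ⟨hw.1.le, h⟩).symm
    · exact (b.curve_eq_straightPt_of_mem_right HU hl hl2 hW hrA hrA8 hB hAB ⟨h, hw.2.le⟩).symm
  · exact b.hostPiece_eq_curve_of_not_mem HU hl hl2 hW hrA hB hAB hw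

include hrA8 in
/-- The host piece function is a unit vector. [folklore] -/
theorem norm_hostPiece (s : ℝ) : ‖b.hostPiece HU hl hl2 hW hrA hB hAB s‖ = 1 := by
  by_cases hs : s ∈ Icc (b.winLo HU hl) (b.winHi HU hl)
  · rw [b.hostPiece_eq_straightPt_of_mem HU hl hl2 hW hrA hrA8 hB hAB hs, straightPt]; exact norm_eq_of_mem_sphere _
  · rw [b.hostPiece_eq_curve_of_not_mem HU hl hl2 hW hrA hB hAB (fun h ↦ hs (Ioo_subset_Icc_self h))]
    exact Knot.norm_curve _ _

include hl2 in
/-- The window lies inside `[alo + seamEps, alo + 1 - seamEps]`. [folklore] -/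
theorem window_subset_seam : Icc (b.winLo HU hl) (b.winHi HU hl) ⊆ Icc (b.alo + b.seamEps) (b.alo + 1 - b.seamEps) :=
  (b.window_subset_contentSet HU hl hl2).trans (b.contentSet_subset_seam HU.cone)

/-- **The seam property of the host piece function.** [folklore] -/
theorem hostPiece_seam : ∀ t ∈ Ioo (b.alo - b.seamEps) (b.alo + b.seamEps),
    b.hostPiece HU hl hl2 hW hrA hB hAB (t + 1) = b.hostPiece HU hl hl2 hW hrA hB hAB t := by
  intro t ht
  have hw1 := (b.window_subset_seam HU hl hl2 ⟨le_rfl, (b.winLo_lt_collarLo HU hl hl2).le.trans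
    ((b.collarLo_lt_collarHi HU hl hl2).le.trans (b.collarHi_lt_winHi HU hl hl2).le)⟩).1
  have hw2 := (b.window_subset_seam HU hl hl2 ⟨(b.winLo_lt_collarLo HU hl hl2).le.trans
    ((b.collarLo_lt_collarHi HU hl hl2).le.trans (b.collarHi_lt_winHi HU hl hl2).le), le_rfl⟩).2
  rw [b.hostPiece_eq_curve_of_not_mem HU hl hl2 hW hrA hB hAB (fun h ↦ by linarith [h.2, ht.1]),
    b.hostPiece_eq_curve_of_not_mem HU hl hl2 hW hrA hB hAB (fun h ↦ by linarith [h.1, ht.2]),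
    (Knot.periodic_curve _) t]

/-- **The straight piece is regular on the window.** [folklore] -/
theorem deriv_straightPt_ne_zero {s : ℝ} (hs : s ∈ Icc (b.winLo HU hl) (b.winHi HU hl)) :
    deriv (b.straightPt HU hl hl2) s ≠ 0 := by
  have hκ := HU.cone.spike.κ_pos
  have hσ := b.depthSign_sq
  have hr := ((b.contDiff_clockFn HU hl hl2).differentiable (by simp) s).hasDerivAt
  have hc : HasDerivAt (fun s ↦ b.blowDown hcross κ (cO b.depthSign + b.clockFn HU hl hl2 s • dLo b.depthSign))
      (κ • b.frame hcross (deriv (b.clockFn HU hl hl2) s • dLo b.depthSign)) s := by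
    have h1 := (hr.smul_const (dLo b.depthSign)).const_add (cO b.depthSign)
    have h2 := (((b.frame hcross : (𝔼 3) ≃L[ℝ] 𝔼 3) : (𝔼 3) →L[ℝ] 𝔼 3).hasFDerivAt.comp_hasDerivAt s h1)
    exact (h2.const_smul κ).const_add b.pZero
  refine deriv_coe_psiN_symm_comp_ne_zero hc (smul_ne_zero hκ.ne'
    ((b.frame hcross).map_ne_zero_iff.2 (smul_ne_zero (b.deriv_clockFn_pos HU hl hl2 hs).ne' (fun h0 ↦ ?_))))
  have := aCL_dLo hσ
  rw [h0, map_zero] at this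
  exact zero_ne_one this

include hrA8 in
/-- **The host piece function is regular.** [folklore] -/
theorem deriv_hostPiece_ne_zero (s : ℝ) : deriv (b.hostPiece HU hl hl2 hW hrA hB hAB) s ≠ 0 := by
  have h12 := b.winLo_lt_collarLo HU hl hl2
  have h56 := b.collarHi_lt_winHi HU hl hl2
  by_cases h1 : s < b.collarLo HU hl
  · have hev : b.hostPiece HU hl hl2 hW hrA hB hAB =ᶠ[𝓝 s] Knot.curve (b.bentKnot HU hW hl hrA hB hAB) := by
      filter_upwards [Iio_mem_nhds h1] with s' hs'
      exact b.hostPiece_eq_curve_of_not_mem_collar HU hl hl2 hW hrA hrA8 hB hAB (fun h ↦ by linarith [h.1, hs'.out])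
    rw [hev.deriv_eq]; exact Knot.deriv_curve_ne_zero _ _
  by_cases h2 : b.collarHi HU hl < s
  · have hev : b.hostPiece HU hl hl2 hW hrA hB hAB =ᶠ[𝓝 s] Knot.curve (b.bentKnot HU hW hl hrA hB hAB) := by
      filter_upwards [Ioi_mem_nhds h2] with s' hs'
      exact b.hostPiece_eq_curve_of_not_mem_collar HU hl hl2 hW hrA hrA8 hB hAB (fun h ↦ by linarith [h.2, hs'.out])
    rw [hev.deriv_eq]; exact Knot.deriv_curve_ne_zero _ _
  push Not at h1 h2
  have hev : b.hostPiece HU hl hl2 hW hrA hB hAB =ᶠ[𝓝 s] b.straightPt HU hl hl2 := by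
    filter_upwards [Ioo_mem_nhds (show b.winLo HU hl < s by linarith) (show s < b.winHi HU hl by linarith)] with s' hs'
    exact b.hostPiece_eq_straightPt_of_mem HU hl hl2 hW hrA hrA8 hB hAB (Ioo_subset_Icc_self hs')
  rw [hev.deriv_eq]
  exact b.deriv_straightPt_ne_zero HU hl hl2 ⟨by linarith, by linarith⟩

/-! ### Injectivity -/

/-- `‖dLo‖ < 2`. [folklore] -/
theorem norm_dLo_lt_two : ‖dLo b.depthSign‖ < 2 := by
  have h := norm_dLo_sq b.depthSign_sq
  nlinarith [norm_nonneg (dLo b.depthSign)]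

/-- The blow-up coordinates of the straight piece: `O + r(s) dLo`. [folklore] -/
theorem eq_of_coe_psiN_symm_eq_straightPt {y : 𝔼 3} {s : ℝ}
    (h : ((psiN.symm y : 𝕊 3) : 𝔼 4) = b.straightPt HU hl hl2 s) :
    b.blowUp hcross κ y = cO b.depthSign + b.clockFn HU hl hl2 s • dLo b.depthSign := by
  have h1 := coe_psiN_symm_injective h
  rw [h1, b.blowUp_blowDown hcross HU.cone.spike.κ_pos.ne']

/-- **The straight piece is injective on the window.** [folklore] -/
theorem injOn_straightPt : InjOn (b.straightPt HU hl hl2) (Icc (b.winLo HU hl) (b.winHi HU hl)) := by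
  intro s hs t ht hst
  have h1 := b.eq_of_coe_psiN_symm_eq_straightPt HU hl hl2 hst
  rw [b.blowUp_blowDown hcross HU.cone.spike.κ_pos.ne', add_right_inj] at h1
  have hd : dLo b.depthSign ≠ 0 := fun h0 ↦ by
    have := aCL_dLo b.depthSign_sq; rw [h0, map_zero] at this; exact zero_ne_one this
  exact (b.strictMonoOn_clockFn HU hl hl2).injOn hs ht (smul_left_injective ℝ hd h1)

/-- The annular cut-off is `< 1` beyond the squared coordinate radius `1/4`. [folklore] -/
theorem annulusCut_lt_one {rA x : ℝ} (hx : 1 / 4 < x) : annulusCut rA x < 1 := by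
  rw [annulusCut]
  have h1 := smoothStep_mem_Icc (rA ^ 2) (4 * rA ^ 2) x
  rcases lt_or_ge x (9 / 16) with h2 | h2
  · have h3 := smoothStep_mem_Ioo (show (1 / 4 : ℝ) < 9 / 16 by norm_num) ⟨hx, h2⟩
    nlinarith [h1.1, h1.2, h3.1, h3.2]
  · rw [smoothStep_of_ge (by norm_num) h2]; norm_num

include hl2 in
/-- A general content parameter lies in the window. [folklore] -/
theorem mem_window_of_general {t : ℝ}
    (hts : t ∈ b.contentSet HU.cone.spike.κ_pos HU.cone.spike.seven_le_gapLo HU.cone.spike.seven_le_gapHi)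
    (hg1 : 3 / 4 < b.alphaLo κ t) (hg2 : 3 / 4 < b.alphaHi κ t) : t ∈ Icc (b.winLo HU hl) (b.winHi HU hl) := by
  have hκ := HU.cone.spike.κ_pos
  have hjl := (b.juncLo_spec hκ HU.cone.spike.seven_le_gapLo).1
  have hjh := (b.juncHi_spec hκ HU.cone.spike.seven_le_gapHi).1
  have hε := b.epsLo_bounds.1
  have hε' := b.epsHi_bounds.1
  have hcc := b.coreLo_lt_coreHi
  have hw1 := b.winLo_mem_core HU hl
  have hw2 := b.winHi_mem_core HU hl
  have hi1 := b.innerLo_mem_core HU hl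
  have hi2 := b.innerHi_mem_core HU hl
  have h12 := b.winLo_lt_collarLo HU hl hl2
  have h23 := b.collarLo_lt_innerLo HU hl hl2
  have h45 := b.innerHi_lt_collarHi HU hl hl2
  have h56 := b.collarHi_lt_winHi HU hl hl2
  have hαi1 := (b.alphaLo_clockLo_mem HU hl hl2 quarter_mem_Icc).2
  have hαi2 := (b.alphaHi_clockHi_mem HU hl hl2 quarter_mem_Icc).2
  constructor
  · by_contra hlt
    push Not at hlt
    have htc : t ∈ Icc (b.tcLo - b.epsLo / 8) (b.tcLo + b.epsLo / 8) := ⟨by linarith [hts.1, hjl.1], by linarith [hw1.2]⟩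
    have := (b.strictMonoOn_alphaLo hκ).monotoneOn htc hi1 (by linarith : t ≤ b.innerLo HU hl)
    exact absurd hg1 (by push Not; exact this.trans hαi1.le)
  · by_contra hlt
    push Not at hlt
    have htc : t ∈ Icc (b.tcHi - b.epsHi / 8) (b.tcHi + b.epsHi / 8) := ⟨by linarith [hw2.1], by linarith [hts.2, hjh.2]⟩
    have := (b.strictAntiOn_alphaHi hκ).antitoneOn hi2 htc (by linarith : b.innerHi HU hl ≤ t)
    exact absurd hg2 (by push Not; exact this.trans hαi2.le)

include hrA8 in
/-- **The bent knot off the window avoids the straight segment**: for a clear wall frame in normal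
position, `curve t ≠ straightPt s` for `t ∈ [alo, alo + 1)` off the window and `s` in the window
(walls by their coordinates or their distance from `O`, the lower spike by its clock value `> 1/2`,
the upper spike by its second coordinate, the unit lies inside the window). [folklore] -/
theorem curve_ne_straightPt (hclear : b.IsBendClear HU.cone F) (hA : A.InNorth) {t : ℝ} (ht : t ∈ Ico b.alo (b.alo + 1))
    (htw : t ∉ Icc (b.winLo HU hl) (b.winHi HU hl)) {s : ℝ} (hs : s ∈ Icc (b.winLo HU hl) (b.winHi HU hl)) :
    Knot.curve (b.bentKnot HU hW hl hrA hB hAB) t ≠ b.straightPt HU hl hl2 s := by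
  have h := HU.cone
  have hκ := h.spike.κ_pos
  have hσ := b.depthSign_sq
  have hρ := b.clockFn_mem HU hl hl2 hs
  have hdLo := b.norm_dLo_lt_two
  -- a point at blow-up distance `≥ 2` from `O` is not on the segment
  have far_ne : ∀ {x : 𝕊 3}, (x ≠ northPole → 2 ≤ ‖b.blowUp hcross κ (psiN x) - cO b.depthSign‖) →
      (x : 𝔼 4) ≠ b.straightPt HU hl hl2 s := fun {x} hx he ↦ by
    have hxe : x = psiN.symm (b.blowDown hcross κ (cO b.depthSign + b.clockFn HU hl hl2 s • dLo b.depthSign)) := Subtype.ext he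
    have hN : x ≠ northPole := by rw [hxe]; exact psiN_symm_ne_northPole _
    have h2 := hx hN
    rw [hxe, psiN_apply_psiN_symm, b.blowUp_blowDown hcross hκ.ne', add_sub_cancel_left, norm_smul, Real.norm_eq_abs] at h2
    have : |b.clockFn HU hl hl2 s| ≤ 1 / 2 := abs_le.2 ⟨by linarith [hρ.1], hρ.2⟩
    nlinarith [norm_nonneg (dLo b.depthSign)]
  rw [Knot.curve_apply]
  by_cases hts : t ∈ b.contentSet h.spike.κ_pos h.spike.seven_le_gapLo h.spike.seven_le_gapHi
  · rcases b.contentKind_cases h hts with ⟨htc, hα⟩ | ⟨htc, hα⟩ | ⟨hg1, hg2⟩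
    · -- lower spike: clock value `> 1/2`
      have htc' := Ioo_subset_Icc_self htc
      rw [b.bentKnot_circlePt_lowerSpike HU hW hl hrA hB hAB htc' hα, b.rayLo_eq_blowDown HU]
      intro he
      have h1 := b.eq_of_coe_psiN_symm_eq_straightPt HU hl hl2 he
      rw [b.blowUp_blowDown hcross hκ.ne', add_right_inj] at h1
      have hd : dLo b.depthSign ≠ 0 := fun h0 ↦ by
        have := aCL_dLo hσ; rw [h0, map_zero] at this; exact zero_ne_one this
      have h2 := smul_left_injective ℝ hd h1
      have hlt : t < b.winLo HU hl := by
        by_contra hle; push Not at hle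
        exact htw ⟨hle, by linarith [htc.2, (b.winHi_mem_core HU hl).1, b.coreLo_lt_coreHi]⟩
      have := b.lt_psiLo_of_lt_clockLo HU hl hl2 half_mem_Icc htc' hlt
      rw [psiLo] at this
      linarith [hρ.1, hρ.2]
    · -- upper spike: second coordinate
      have htc' := Ioo_subset_Icc_self htc
      rw [b.bentKnot_circlePt_upperSpike HU hW hl hrA hB hAB htc' hα]
      intro he
      have h1 := b.eq_of_coe_psiN_symm_eq_straightPt HU hl hl2 he
      rw [b.blowUp_blowDown hcross hκ.ne'] at h1
      have hgt : b.winHi HU hl < t := by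
        by_contra hle; push Not at hle
        exact htw ⟨by linarith [htc.1, (b.winLo_mem_core HU hl).2, b.coreLo_lt_coreHi], hle⟩
      have hψ := b.lt_psiHi_of_clockHi_lt HU hl hl2 half_mem_Icc htc' hgt
      rw [psiHi] at hψ
      set ψ := spikeScalar (1 * (1 - lam₀)) (b.alphaHi κ t)
      have hb := congrArg (bCL b.depthSign) h1
      rw [map_add, map_smul, bCL_dLo hσ, smul_eq_mul, mul_zero, add_zero, bendArc, map_add, map_add, map_smul, map_smul,
        bCL_dLo hσ, bCL_dHi hσ] at hb
      simp only [smul_eq_mul, mul_zero, add_zero, mul_one, add_eq_left] at hb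
      -- `ψ cos x = 0` with `ψ > 1/2` and `cos x > 0`
      have hc01 := annulusCut_mem_Icc rA (ψ ^ 2)
      have hc1 : annulusCut rA (ψ ^ 2) < 1 := annulusCut_lt_one (by nlinarith)
      have hcos : 0 < Real.cos (π / 2 * annulusCut rA (ψ ^ 2) * 1) := by
        apply Real.cos_pos_of_mem_Ioo
        constructor
        · have := Real.pi_pos; nlinarith [hc01.1]
        · have := Real.pi_pos; nlinarith [hc01.2]
      rw [mul_one] at hcos
      rcases mul_eq_zero.1 hb with h0 | h0
      · linarith
      · linarith
    · exact absurd (b.mem_window_of_general HU hl hl2 hts hg1 hg2) htw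
  · -- walls
    rw [b.bentKnot_circlePt_of_not_mem HU hW hclear hA hl hrA hB hAB ht hts]
    rcases hclear t ht hts with he | ⟨x', hx', hfar'⟩
    · rcases b.wall_cases h hA ht hts with ⟨-, hαt, hqt, hwt⟩ | ⟨-, hαt, hqt, hwt⟩ | ⟨hfar, x₀, hx₀, -⟩
      · rw [he, hwt]
        intro heq
        have h1 := b.eq_of_coe_psiN_symm_eq_straightPt HU hl hl2 heq
        have ha := b.aCL_blowUp_pieceLo_one_le HU hαt hqt
        rw [h1, add_sub_cancel_left, map_smul, aCL_dLo hσ, smul_eq_mul, mul_one] at ha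
        linarith [hρ.1]
      · rw [he, hwt]
        intro heq
        have h1 := b.eq_of_coe_psiN_symm_eq_straightPt HU hl hl2 heq
        have hb' := b.le_bCL_blowUp_pieceHi_one HU hαt hqt
        rw [h1, add_sub_cancel_left, map_smul, bCL_dLo hσ, smul_eq_mul, mul_zero] at hb'
        linarith
      · rw [he, hx₀]
        rw [hx₀] at hfar
        exact far_ne (fun hN ↦ b.two_le_norm_blowUp_sub_cO_of_mem_farSet HU hfar hN)
    · rw [hx']
      exact far_ne hfar'

include hrA8 in
/-- **The host piece function is injective on the fundamental domain** (clear wall frame, normal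
position). [folklore] -/
theorem injOn_hostPiece (hclear : b.IsBendClear HU.cone F) (hA : A.InNorth) :
    InjOn (b.hostPiece HU hl hl2 hW hrA hB hAB) (Ico b.alo (b.alo + 1)) := by
  intro s hs t ht hst
  by_cases hsw : s ∈ Icc (b.winLo HU hl) (b.winHi HU hl) <;> by_cases htw : t ∈ Icc (b.winLo HU hl) (b.winHi HU hl)
  · rw [b.hostPiece_eq_straightPt_of_mem HU hl hl2 hW hrA hrA8 hB hAB hsw, b.hostPiece_eq_straightPt_of_mem HU hl hl2 hW hrA hrA8 hB hAB htw] at hst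
    exact b.injOn_straightPt HU hl hl2 hsw htw hst
  · rw [b.hostPiece_eq_straightPt_of_mem HU hl hl2 hW hrA hrA8 hB hAB hsw,
      b.hostPiece_eq_curve_of_not_mem HU hl hl2 hW hrA hB hAB (fun h ↦ htw (Ioo_subset_Icc_self h))] at hst
    exact absurd hst.symm (b.curve_ne_straightPt HU hl hl2 hW hrA hrA8 hB hAB hclear hA ht htw hsw)
  · rw [b.hostPiece_eq_straightPt_of_mem HU hl hl2 hW hrA hrA8 hB hAB htw,
      b.hostPiece_eq_curve_of_not_mem HU hl hl2 hW hrA hB hAB (fun h ↦ hsw (Ioo_subset_Icc_self h))] at hst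
    exact absurd hst (b.curve_ne_straightPt HU hl hl2 hW hrA hrA8 hB hAB hclear hA hs hsw htw)
  · rw [b.hostPiece_eq_curve_of_not_mem HU hl hl2 hW hrA hB hAB (fun h ↦ hsw (Ioo_subset_Icc_self h)),
      b.hostPiece_eq_curve_of_not_mem HU hl hl2 hW hrA hB hAB (fun h ↦ htw (Ioo_subset_Icc_self h))] at hst
    exact Knot.injOn_curve_Ico _ b.alo hs ht hst

/-! ### The host knot -/

/-- **The host loop**: the periodisation of the host piece function. [folklore] -/
def hostLoop : ℝ → 𝔼 4 := periodise b.alo (b.hostPiece HU hl hl2 hW hrA hB hAB)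

include hrA8 in
/-- **The host loop is a regular loop.** [folklore] -/
theorem isRegularLoop_hostLoop : IsRegularLoop (b.hostLoop HU hl hl2 hW hrA hB hAB) :=
  isRegularLoop_periodise (b.contDiff_hostPiece HU hl hl2 hW hrA hB hAB) b.seamEps_bounds.1
    (b.hostPiece_seam HU hl hl2 hW hrA hB hAB) (fun s _ ↦ b.norm_hostPiece HU hl hl2 hW hrA hrA8 hB hAB s)
    (fun s _ ↦ b.deriv_hostPiece_ne_zero HU hl hl2 hW hrA hrA8 hB hAB s)

/-- **The host knot** of the bent knot of a clear wall frame in normal position. [folklore] -/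
def hostKnot (hclear : b.IsBendClear HU.cone F) (hA : A.InNorth) : Knot :=
  (b.isRegularLoop_hostLoop HU hl hl2 hW hrA hrA8 hB hAB).toKnot
    (periodise_simple_iff.2 (b.injOn_hostPiece HU hl hl2 hW hrA hrA8 hB hAB hclear hA))

/-- The host knot on the circle point of parameter `t`. [folklore] -/
theorem coe_hostKnot_circlePt (hclear : b.IsBendClear HU.cone F) (hA : A.InNorth) (t : ℝ) :
    ((b.hostKnot HU hl hl2 hW hrA hrA8 hB hAB hclear hA (circlePt t) : 𝕊 3) : 𝔼 4) = b.hostLoop HU hl hl2 hW hrA hB hAB t :=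
  (b.isRegularLoop_hostLoop HU hl hl2 hW hrA hrA8 hB hAB).coe_toKnot_circlePt _ t

/-- The curve of the host knot is the host loop. [folklore] -/
theorem curve_hostKnot (hclear : b.IsBendClear HU.cone F) (hA : A.InNorth) :
    Knot.curve (b.hostKnot HU hl hl2 hW hrA hrA8 hB hAB hclear hA) = b.hostLoop HU hl hl2 hW hrA hB hAB := by
  funext t; exact b.coe_hostKnot_circlePt HU hl hl2 hW hrA hrA8 hB hAB hclear hA t

/-- **On the fundamental domain the host loop is the host piece function.** [folklore] -/
theorem hostLoop_of_mem {t : ℝ} (ht : t ∈ Ico b.alo (b.alo + 1)) :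
    b.hostLoop HU hl hl2 hW hrA hB hAB t = b.hostPiece HU hl hl2 hW hrA hB hAB t :=
  periodise_eq_self b.alo _ ht

include hl2 in
/-- The window lies in the fundamental domain. [folklore] -/
theorem window_subset_Ico : Icc (b.winLo HU hl) (b.winHi HU hl) ⊆ Ico b.alo (b.alo + 1) :=
  (b.window_subset_contentSet HU hl hl2).trans (b.contentSet_subset_Ico HU.cone)

include hrA8 in
/-- **On the window the host loop is the straight piece.** [folklore] -/
theorem hostLoop_of_mem_window {t : ℝ} (ht : t ∈ Icc (b.winLo HU hl) (b.winHi HU hl)) :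
    b.hostLoop HU hl hl2 hW hrA hB hAB t = b.straightPt HU hl hl2 t := by
  rw [b.hostLoop_of_mem HU hl hl2 hW hrA hB hAB (b.window_subset_Ico HU hl hl2 ht),
    b.hostPiece_eq_straightPt_of_mem HU hl hl2 hW hrA hrA8 hB hAB ht]

include hrA8 in
/-- **Off the open collar interval, on the fundamental domain, the host loop is the bent knot.**
[folklore] -/
theorem hostLoop_of_not_mem_collar {t : ℝ} (ht : t ∈ Ico b.alo (b.alo + 1)) (htc : t ∉ Ioo (b.collarLo HU hl) (b.collarHi HU hl)) :
    b.hostLoop HU hl hl2 hW hrA hB hAB t = Knot.curve (b.bentKnot HU hW hl hrA hB hAB) t := by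
  rw [b.hostLoop_of_mem HU hl hl2 hW hrA hB hAB ht, b.hostPiece_eq_curve_of_not_mem_collar HU hl hl2 hW hrA hrA8 hB hAB htc]

end BandData

end Literature.Topology.FourManifolds
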